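/-
COR-CM (cell pub-hodgecm2, stage 2 of the Hodge ladder) — count-neutral KERNEL COMBINATORICS «the binary tetrahedral group SL(2,3)», part VI: the ORBIT SPAN of a
family under the motions of `SL(2,3)` and its value module (seat prover-pub-hodgecm2-b23-g53-0, binder prover b23, gen 53; claim HOME/INBOX.md l.24246, NAME
ASK l.24300).  Bookkeeping definitions with bodies (`orbSpan`, `valMod`) + theorems — gen 45ʼs `Census/OcticProductOrbit.lean` with the free slot translation
`translH₄ (0, σ)` replaced by the sheared translation `translA σ` of part IV (slots are no longer free: they move together with the coordinate rotation); on gen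
44ʼs label-level lane BY NAME; no `Prop`-valued definition, no `decide` beyond closed identities in `Bool`/`Fin 4`, no certificate, no named fact, no `sorry`.
`Interfaces.lean` (C1), every E term, B01, `Transposition/*`, `PortJoin/*`, `D2Bridge/*` untouched.
HONEST FRAMING: `HC_CM` is NOT proved, here or anywhere in the tree; nothing here is a period, a count of record or a headline.
T5: n/a-class (no hypothesis binders beyond `Odd |A|`); checker: self.
-/
import Summits.HodgeConjecture.CorCM.Census.QuarticInversionGenerators
import Summits.HodgeConjecture.CorCM.Census.QuarticInversionTrees
import Summits.HodgeConjecture.CorCM.Census.OcticProductEquivariance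
import Summits.HodgeConjecture.CorCM.Census.BinaryTetrahedralEquivariance

/-!
# The binary tetrahedral group, VI: the orbit span of a family, its value module, moving binomials

* §1 **The orbit span** `orbSpan σ F` of a family `F ⊆ ℤ[Ty₄ A]`: the least submodule containing `F` and stable under the central translations
  `translH₄ (ζ, 0)` (`c`), gen 45ʼs `translZ 1` (`i`), gen 44ʼs `translT` (`k`) and the sheared translation `translA σ` (`a`) — the span of the
  `SL(2,3)`-translates of `F` when `A = ℤ/3`, `σ = 1`; it lies in `hodge₄` when `F` does.  **The value module** `valMod σ F = Avec (orbSpan σ F)`.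
* §2 **Moving binomials inside the value module**, one position `(j, u)` at a time (there is NO free slot translation): by `i` and `k` (coordinate
  `σY j` / `σT j`, same slot, gen 44ʼs pattern maps) and by `a` (coordinate `σA j`, slot `u − σ`, patterns `∘ ρA`); and ALL-PATTERN transport: if every
  binomial of position `(j, u)` lies in the value module, so does every binomial of the moved position (`Z_all`, `T_all`, `A_all`).
* §3 **The source of binomials**: the value vector of a mixed closing face of the family is a slot binomial at ITS slot (`mix_mem₀`).
* §4 Normal forms: `nf v ∈ valMod` for `v ∈ orbSpan` once all binomials are there; `kOf`/`nf` of `a`-translates of Hodge vectors.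
All [folklore] bookkeeping over [Pohlmann1968, Thm 1].

## References
* [Pohlmann1968] H. Pohlmann, Algebraic cycles on abelian varieties of complex multiplication type, Ann. of Math. 88 (1968), Thm 1.
-/

namespace Summit.HodgeConjecture.CorCM.Census.BinaryTetrahedral

open Finset
open Summit.HodgeConjecture.CorCM.Census.OddSliceFacesModel
open Summit.HodgeConjecture.CorCM.Census.QuarticInversion
open Summit.HodgeConjecture.CorCM.Census.OcticProduct (twZ twZinv translZ translZ_mem Avec_translZ_of_binVec fnl_wC_translZ)

noncomputable section

variable (A : Type) [AddCommGroup A] [Fintype A] [DecidableEq A] (σ : A)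

/-! ## §1 The orbit span and the value module -/

/-- **The orbit span of `F`** under `c`, `i`, `k`, `a`: the least submodule containing `F` and stable under `translH₄ (ζ, 0)`, `translZ 1`, `translT` and
`translA σ`. [folklore] -/
def orbSpan (F : Set (Ty₄ A → ℤ)) : Submodule ℤ (Ty₄ A → ℤ) :=
  sInf {N | F ⊆ N ∧ (∀ ζ : ZMod 2, ∀ v ∈ N, translH₄ A (ζ, 0) v ∈ N) ∧ (∀ v ∈ N, translZ A 1 v ∈ N) ∧ (∀ v ∈ N, translT A v ∈ N) ∧
    (∀ v ∈ N, translA A σ v ∈ N)}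

omit [Fintype A] [DecidableEq A] in
/-- `F ⊆ orbSpan F`. [folklore] -/
theorem subset_orbSpan (F : Set (Ty₄ A → ℤ)) {f : Ty₄ A → ℤ} (hf : f ∈ F) : f ∈ orbSpan A σ F := by
  rw [orbSpan, Submodule.mem_sInf]
  intro N hN
  exact hN.1 hf

omit [Fintype A] [DecidableEq A] in
/-- The orbit span is stable under the central translations. [folklore] -/
theorem translH₄_mem_orbSpan (F : Set (Ty₄ A → ℤ)) (ζ : ZMod 2) {v : Ty₄ A → ℤ} (hv : v ∈ orbSpan A σ F) :
    translH₄ A (ζ, 0) v ∈ orbSpan A σ F := by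
  rw [orbSpan, Submodule.mem_sInf] at hv ⊢
  intro N hN
  exact hN.2.1 ζ v (hv N hN)

omit [Fintype A] [DecidableEq A] in
/-- The orbit span is stable under `i`. [folklore] -/
theorem translZ_mem_orbSpan (F : Set (Ty₄ A → ℤ)) {v : Ty₄ A → ℤ} (hv : v ∈ orbSpan A σ F) : translZ A 1 v ∈ orbSpan A σ F := by
  rw [orbSpan, Submodule.mem_sInf] at hv ⊢
  intro N hN
  exact hN.2.2.1 v (hv N hN)

omit [Fintype A] [DecidableEq A] in
/-- The orbit span is stable under `k`. [folklore] -/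
theorem translT_mem_orbSpan (F : Set (Ty₄ A → ℤ)) {v : Ty₄ A → ℤ} (hv : v ∈ orbSpan A σ F) : translT A v ∈ orbSpan A σ F := by
  rw [orbSpan, Submodule.mem_sInf] at hv ⊢
  intro N hN
  exact hN.2.2.2.1 v (hv N hN)

omit [Fintype A] [DecidableEq A] in
/-- The orbit span is stable under `a`. [folklore] -/
theorem translA_mem_orbSpan (F : Set (Ty₄ A → ℤ)) {v : Ty₄ A → ℤ} (hv : v ∈ orbSpan A σ F) : translA A σ v ∈ orbSpan A σ F := by
  rw [orbSpan, Submodule.mem_sInf] at hv ⊢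
  intro N hN
  exact hN.2.2.2.2 v (hv N hN)

omit [Fintype A] [DecidableEq A] in
/-- **Induction**: a stable submodule containing `F` contains the orbit span. [folklore] -/
theorem orbSpan_le {F : Set (Ty₄ A → ℤ)} {N : Submodule ℤ (Ty₄ A → ℤ)} (hF : F ⊆ N) (hH : ∀ ζ : ZMod 2, ∀ v ∈ N, translH₄ A (ζ, 0) v ∈ N)
    (hZ : ∀ v ∈ N, translZ A 1 v ∈ N) (hT : ∀ v ∈ N, translT A v ∈ N) (hAa : ∀ v ∈ N, translA A σ v ∈ N) : orbSpan A σ F ≤ N :=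
  sInf_le ⟨hF, hH, hZ, hT, hAa⟩

omit [Fintype A] [DecidableEq A] in
/-- The orbit span is monotone in the family. [folklore] -/
theorem orbSpan_mono {F F' : Set (Ty₄ A → ℤ)} (h : F ⊆ F') : orbSpan A σ F ≤ orbSpan A σ F' :=
  orbSpan_le A σ (fun _ hf => subset_orbSpan A σ F' (h hf)) (fun ζ _ hv => translH₄_mem_orbSpan A σ F' ζ hv)
    (fun _ hv => translZ_mem_orbSpan A σ F' hv) (fun _ hv => translT_mem_orbSpan A σ F' hv) (fun _ hv => translA_mem_orbSpan A σ F' hv)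

/-- The orbit span of a family of Hodge vectors lies in `hodge₄`. [folklore] -/
theorem orbSpan_le_hodge₄ {F : Set (Ty₄ A → ℤ)} (hF : F ⊆ hodge₄ A) : orbSpan A σ F ≤ hodge₄ A :=
  orbSpan_le A σ hF (fun ζ _ hv => translH₄_mem A hv (ζ, 0)) (fun _ hv => translZ_mem A 1 hv) (fun _ hv => translT_mem A hv)
    (fun _ hv => translA_mem A σ hv)

/-- **The value module** of `F`: the value vectors of the orbit span. [folklore] -/
def valMod (F : Set (Ty₄ A → ℤ)) : Submodule ℤ (Idx A → ℤ) := (orbSpan A σ F).map (Avec A)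

/-- Value vectors of members of the orbit span lie in the value module. [folklore] -/
theorem Avec_mem_valMod (F : Set (Ty₄ A → ℤ)) {v : Ty₄ A → ℤ} (hv : v ∈ orbSpan A σ F) : Avec A v ∈ valMod A σ F :=
  Submodule.mem_map_of_mem hv

/-! ## §2 Moving binomials inside the value module -/

variable {σ}

/-- **Moved by `i`, off the mask** (coordinates `0, 2`): same slot, patterns by `qY 1`. [folklore] -/
theorem Z_mem (hA : Odd (Fintype.card A)) {F : Set (Ty₄ A → ℤ)} {j j' : Fin 4} {h h' g g' : Fin 4 → Bool} {u : A}
    (hb : bY 1 (σY j) = false) (ej : σY j = j') (e1 : qY 1 h = g) (e2 : qY 1 h' = g') (H : binVec A j h h' u ∈ valMod A σ F) :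
    binVec A j' g g' u ∈ valMod A σ F := by
  obtain ⟨c, hc, e⟩ := Submodule.mem_map.mp H
  have hy : Avec A (translZ A 1 c) = binVec A j' g g' u := by
    rw [Avec_translZ_of_binVec A hA 1 e, hb]; simp only [Bool.false_eq_true, if_false, ej, e1, e2]
  exact Submodule.mem_map.mpr ⟨translZ A 1 c, translZ_mem_orbSpan A σ F hc, hy⟩

/-- **Moved by `i`, on the mask** (coordinates `1, 3`): patterns complemented and swapped. [folklore] -/
theorem Z_mem' (hA : Odd (Fintype.card A)) {F : Set (Ty₄ A → ℤ)} {j j' : Fin 4} {h h' g g' : Fin 4 → Bool} {u : A}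
    (hb : bY 1 (σY j) = true) (ej : σY j = j') (e1 : qY 1 (fun n => !h' n) = g) (e2 : qY 1 (fun n => !h n) = g')
    (H : binVec A j h h' u ∈ valMod A σ F) : binVec A j' g g' u ∈ valMod A σ F := by
  obtain ⟨c, hc, e⟩ := Submodule.mem_map.mp H
  have hy : Avec A (translZ A 1 c) = binVec A j' g g' u := by
    rw [Avec_translZ_of_binVec A hA 1 e, hb]; simp only [if_true, ej, e1, e2]
  exact Submodule.mem_map.mpr ⟨translZ A 1 c, translZ_mem_orbSpan A σ F hc, hy⟩

/-- **Moved by `k`, off the mask** (coordinates `0, 3`). [folklore] -/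
theorem T_mem (hA : Odd (Fintype.card A)) {F : Set (Ty₄ A → ℤ)} {j j' : Fin 4} {h h' g g' : Fin 4 → Bool} {u : A}
    (hb : bT (σT j) = false) (ej : σT j = j') (e1 : qT h = g) (e2 : qT h' = g') (H : binVec A j h h' u ∈ valMod A σ F) :
    binVec A j' g g' u ∈ valMod A σ F := by
  obtain ⟨c, hc, e⟩ := Submodule.mem_map.mp H
  have ht : Avec A (translT A c) = binVec A j' g g' u := by
    rw [Avec_translT_of_binVec A hA e, hb]; simp only [Bool.false_eq_true, if_false, ej, e1, e2]
  exact Submodule.mem_map.mpr ⟨translT A c, translT_mem_orbSpan A σ F hc, ht⟩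

/-- **Moved by `k`, on the mask** (coordinates `1, 2`). [folklore] -/
theorem T_mem' (hA : Odd (Fintype.card A)) {F : Set (Ty₄ A → ℤ)} {j j' : Fin 4} {h h' g g' : Fin 4 → Bool} {u : A}
    (hb : bT (σT j) = true) (ej : σT j = j') (e1 : qT (fun n => !h' n) = g) (e2 : qT (fun n => !h n) = g')
    (H : binVec A j h h' u ∈ valMod A σ F) : binVec A j' g g' u ∈ valMod A σ F := by
  obtain ⟨c, hc, e⟩ := Submodule.mem_map.mp H
  have ht : Avec A (translT A c) = binVec A j' g g' u := by
    rw [Avec_translT_of_binVec A hA e, hb]; simp only [if_true, ej, e1, e2]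
  exact Submodule.mem_map.mpr ⟨translT A c, translT_mem_orbSpan A σ F hc, ht⟩

/-- **Moved by `a`**: coordinate `σA j`, patterns `∘ ρA`, slot `u − σ`. [folklore] -/
theorem A_mem {F : Set (Ty₄ A → ℤ)} {j j' : Fin 4} {h h' g g' : Fin 4 → Bool} {u u' : A}
    (ej : σA j = j') (e1 : h ∘ ρA = g) (e2 : h' ∘ ρA = g') (eu : u - σ = u') (H : binVec A j h h' u ∈ valMod A σ F) :
    binVec A j' g g' u' ∈ valMod A σ F := by
  obtain ⟨c, hc, e⟩ := Submodule.mem_map.mp H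
  have ha : Avec A (translA A σ c) = binVec A j' g g' u' := by
    rw [Avec_translA_of_binVec A σ e, ej, e1, e2, eu]
  exact Submodule.mem_map.mpr ⟨translA A σ c, translA_mem_orbSpan A σ F hc, ha⟩

/-- **ALL binomials of a position move by `i`.** [folklore] -/
theorem Z_all (hA : Odd (Fintype.card A)) {F : Set (Ty₄ A → ℤ)} {j j' : Fin 4} {u : A} (ej : σY j = j')
    (H : ∀ h h' : Fin 4 → Bool, binVec A j h h' u ∈ valMod A σ F) : ∀ g g' : Fin 4 → Bool, binVec A j' g g' u ∈ valMod A σ F := by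
  intro g g'
  cases hb : bY 1 (σY j)
  · exact Z_mem A hA hb ej (qY_pY 1 g) (qY_pY 1 g') (H _ _)
  · refine Z_mem' A hA hb ej (h := fun n => !pY 1 g' n) (h' := fun n => !pY 1 g n) ?_ ?_ (H _ _)
    · simp only [Bool.not_not]; exact qY_pY 1 g
    · simp only [Bool.not_not]; exact qY_pY 1 g'

/-- **ALL binomials of a position move by `k`.** [folklore] -/
theorem T_all (hA : Odd (Fintype.card A)) {F : Set (Ty₄ A → ℤ)} {j j' : Fin 4} {u : A} (ej : σT j = j')
    (H : ∀ h h' : Fin 4 → Bool, binVec A j h h' u ∈ valMod A σ F) : ∀ g g' : Fin 4 → Bool, binVec A j' g g' u ∈ valMod A σ F := by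
  intro g g'
  cases hb : bT (σT j)
  · exact T_mem A hA hb ej (qT_pT g) (qT_pT g') (H _ _)
  · refine T_mem' A hA hb ej (h := fun n => !pT g' n) (h' := fun n => !pT g n) ?_ ?_ (H _ _)
    · simp only [Bool.not_not]; exact qT_pT g
    · simp only [Bool.not_not]; exact qT_pT g'

/-- **ALL binomials of a position move by `a`.** [folklore] -/
theorem A_all {F : Set (Ty₄ A → ℤ)} {j j' : Fin 4} {u u' : A} (ej : σA j = j') (eu : u - σ = u')
    (H : ∀ h h' : Fin 4 → Bool, binVec A j h h' u ∈ valMod A σ F) : ∀ g g' : Fin 4 → Bool, binVec A j' g g' u' ∈ valMod A σ F := by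
  intro g g'
  refine A_mem A ej (h := g ∘ σA) (h' := g' ∘ σA) ?_ ?_ eu (H _ _)
  · funext n; simp only [Function.comp, σA_ρA]
  · funext n; simp only [Function.comp, σA_ρA]

/-! ## §3 The source of binomials: mixed closing faces -/

/-- **A mixed closing face of the family gives a binomial at its own position** (patterns supplied as literals via `e1`, `e2`). [folklore] -/
theorem mix_mem₀ (hA : Odd (Fintype.card A)) (h3 : 3 ≤ Fintype.card A) {F : Set (Ty₄ A → ℤ)} {Q : Finset A} {w : A} (hw : w ∉ Q)
    (hQ : Q.card = Fintype.card A / 2) {i : Fin 4} (hi : i ≠ 0) {u : A} {b : Fin 4 → Bool} (hb : b i = true)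
    (hF : mixFace A Q w i u b ∈ F) {g g' : Fin 4 → Bool} (e1 : (fun n => if n = 0 then false else !b n) = g)
    (e2 : (fun n => if n = 0 then true else !b n) = g') : binVec A i g g' u ∈ valMod A σ F := by
  have h := Avec_mem_valMod A σ F (subset_orbSpan A σ F hF)
  rwa [Avec_mixFace A hA h3 hw hQ hi u hb, e1, e2] at h

/-! ## §4 Normal forms -/

/-- **The normal form of a member of the orbit span lies in the value module** once every slot binomial does. [folklore] -/
theorem nf_mem_of_bin (hA : Odd (Fintype.card A)) {F : Set (Ty₄ A → ℤ)} (hF : F ⊆ hodge₄ A)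
    (hbin : ∀ j h h' u, binVec A j h h' u ∈ valMod A σ F) {v : Ty₄ A → ℤ} (hv : v ∈ orbSpan A σ F) :
    nf A v ∈ valMod A σ F := by
  have hle : binSpan A ≤ valMod A σ F := Submodule.span_le.mpr (by rintro _ ⟨j, h, h', u, rfl⟩; exact hbin j h h' u)
  have h1 := Avec_mem_valMod A σ F hv
  have h2 := hle (Avec_sub_nf_mem A hA (orbSpan_le_hodge₄ A σ hF hv))
  have := (valMod A σ F).sub_mem h1 h2
  rwa [sub_sub_cancel] at this

/-- **A value module containing every binomial and the normal forms of the Hodge vectors is all of `Avec (hodge₄)`.** [folklore] -/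
theorem Avec_mem_valMod_of_nf (hA : Odd (Fintype.card A)) {F : Set (Ty₄ A → ℤ)} (hbin : ∀ j h h' u, binVec A j h h' u ∈ valMod A σ F)
    {x : Ty₄ A → ℤ} (hx : x ∈ hodge₄ A) (hnf : nf A x ∈ valMod A σ F) : Avec A x ∈ valMod A σ F :=
  Avec_mem_of_nf_mem A hA hbin hx hnf

/-- `kOf j (a·v) = kOf (ρA j) v` for a Hodge vector `v`. [folklore] -/
theorem kOf_translA (hA : Odd (Fintype.card A)) (j : Fin 4) {v : Ty₄ A → ℤ} (hv : v ∈ hodge₄ A) :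
    kOf A j (translA A σ v) = kOf A (ρA j) v := by
  unfold kOf
  rw [fnl_wUp_translA, fnl_wUp_eq A hA hv (ρA j) (0 + σ) 0]

/-- **The normal form of `a·v`** for a Hodge vector `v`. [folklore] -/
theorem nf_translA (hA : Odd (Fintype.card A)) {v : Ty₄ A → ℤ} (hv : v ∈ hodge₄ A) :
    nf A (translA A σ v) = ΦL A (fun j => kOf A (ρA j) v, fun η => fnl A (wC A (η ∘ σA)) v) := by
  rw [nf_eq_ΦL]
  congr 1
  ext j
  · exact kOf_translA A hA j hv
  · exact fnl_wC_translA A σ _ v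

end

end Summit.HodgeConjecture.CorCM.Census.BinaryTetrahedral
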